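import Literature.Analysis.UnboundedOperators.HeatKernelDirichletForm
import Mathlib.Analysis.Calculus.LineDeriv.IntegrationByParts
import HarnessLib

/-!
# Green's first identity with a weight and the Dirichlet form of `Δ − ∇V·∇` in `L²(e^{−V}dx)`

Analysis/UnboundedOperators file (all results proved, no definitions, no named facts). On a
finite-dimensional real inner product space `E` with its Lebesgue (Haar) measure, for a weight
`ρ ∈ C¹(E)` with `ρ, ‖Dρ‖ ∈ L¹`, and functions `u ∈ C²`, `v ∈ C¹` with `Du, D²u, v, Dv` bounded:

* `laplacian_eq_sum_fderiv_fderiv_apply` — `Δu = ∑ᵢ ∂ᵢ∂ᵢu` along any orthonormal basis, for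
  `u ∈ C²` (Mathlib's `laplacian_eq_iteratedFDeriv_orthonormalBasis` unfolded);
* `integral_mul_mul_fderiv_fderiv_weight` — one weighted integration by parts in the direction `e`:
  `∫ v ρ ∂ₑ∂ₑu = −∫ ∂ₑu ∂ₑv ρ − ∫ v ∂ₑu ∂ₑρ`;
* `integral_laplacian_mul_mul_weight` — **Green's first identity with weight `ρ`**:
  `∫ (Δu) v ρ = −∫ (∑ᵢ ∂ᵢu ∂ᵢv) ρ − ∫ v ∑ᵢ ∂ᵢu ∂ᵢρ`;
* `integral_ornsteinUhlenbeck_mul_mul_weight` — **the Dirichlet form of the drift–diffusion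
  (Ornstein–Uhlenbeck / ground-state conjugated Fokker–Planck) operator `Δ − ∇V·∇` in `L²(ρ dx)`**
  when `Dρ = −(DV) ρ` (i.e. `ρ = c e^{−V}`): `∫ (Δu − ∑ᵢ ∂ᵢV ∂ᵢu) v ρ = −∫ (∑ᵢ ∂ᵢu ∂ᵢv) ρ`, and its
  diagonal case `∫ (Δu − ∑ᵢ ∂ᵢV ∂ᵢu) u ρ = −∫ ‖Du‖² ρ` (`integral_ornsteinUhlenbeck_mul_self_mul_weight`).

These generalise `integral_ornsteinUhlenbeck_mul_mul_heatKernel` (`HeatKernelDirichletForm`, the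
isotropic Gaussian `ρ = G_t`, `V = |x|²/4t`) to arbitrary `C¹` weights; the anisotropic Gaussians
`𝒢_λ` of the asymmetric Burgers vortex problem (Gallay–Maekawa 2016, (4.4)) are the motivating case
(`Literature.Analysis.FluidPDE.GaussianVortexLinearLamGap`).

## References

* D. Bakry, I. Gentil, M. Ledoux, *Analysis and Geometry of Markov Diffusion Operators*,
  Springer 2014, §1.11.3 and §2.7.1 (the operator `Δ − ∇V·∇` is symmetric in `L²(e^{−V})` with
  Dirichlet form `∫ ∇u·∇v e^{−V}`). [folklore]
-/

open MeasureTheory Filter Set InnerProductSpace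
open scoped RealInnerProductSpace Laplacian Topology

noncomputable section

namespace Literature.Analysis.UnboundedOperators

variable {E : Type*} [NormedAddCommGroup E] [InnerProductSpace ℝ E] [FiniteDimensional ℝ E]
  [MeasurableSpace E] [BorelSpace E]

omit [MeasurableSpace E] [BorelSpace E] in
/-- The Laplacian along an orthonormal basis for `C²` functions: `Δu(x) = ∑ᵢ ∂ᵢ(∂ᵢu)(x)` with
`∂ᵢw = Dw(·)(bᵢ)`. [folklore] -/
theorem laplacian_eq_sum_fderiv_fderiv_apply {ι : Type*} [Fintype ι] (b : OrthonormalBasis ι ℝ E)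
    {u : E → ℝ} (hu : ContDiff ℝ 2 u) (x : E) :
    Δ u x = ∑ i, fderiv ℝ (fun y => fderiv ℝ u y (b i)) x (b i) := by
  have hd : DifferentiableAt ℝ (fderiv ℝ u) x :=
    ((hu.fderiv_right (m := 1) le_rfl).differentiable one_ne_zero).differentiableAt
  rw [InnerProductSpace.laplacian_eq_iteratedFDeriv_orthonormalBasis u b]
  refine Finset.sum_congr rfl fun i _ => ?_
  rw [iteratedFDeriv_two_apply, fderiv_clm_apply hd (differentiableAt_const _)]
  simp

section WeightedIBP

variable {ρ u v : E → ℝ} (hρ : ContDiff ℝ 1 ρ) (hρi : Integrable ρ)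
  (hρd : Integrable fun x => ‖fderiv ℝ ρ x‖)
  (hu : ContDiff ℝ 2 u) (hv : ContDiff ℝ 1 v) {C₁ C₂ D₀ D₁ : ℝ}
  (hu1 : ∀ x, ‖fderiv ℝ u x‖ ≤ C₁) (hu2 : ∀ x, ‖fderiv ℝ (fderiv ℝ u) x‖ ≤ C₂)
  (hv0 : ∀ x, ‖v x‖ ≤ D₀) (hv1 : ∀ x, ‖fderiv ℝ v x‖ ≤ D₁)
include hρ hρi hρd hu hv hu1 hu2 hv0 hv1

/-- **One weighted integration by parts.** For `ρ ∈ C¹ ∩ L¹` with `‖Dρ‖ ∈ L¹`, `u ∈ C²` with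
`Du, D²u` bounded and `v ∈ C¹` with `v, Dv` bounded, in any direction `e`:
`∫ v ρ ∂ₑ∂ₑu = −∫ ∂ₑu ∂ₑv ρ − ∫ v ∂ₑu ∂ₑρ` (move one `∂ₑ` onto `vρ`; no boundary terms since all
three products are integrable, `integral_mul_fderiv_eq_neg_fderiv_mul_of_integrable`). [folklore] -/
theorem integral_mul_mul_fderiv_fderiv_weight (e : E) :
    ∫ x, v x * ρ x * fderiv ℝ (fun y => fderiv ℝ u y e) x e =
      -(∫ x, fderiv ℝ u x e * fderiv ℝ v x e * ρ x) -
        ∫ x, v x * fderiv ℝ u x e * fderiv ℝ ρ x e := by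
  have hC₁ : 0 ≤ C₁ := (norm_nonneg _).trans (hu1 0)
  have hD₀ : 0 ≤ D₀ := (norm_nonneg _).trans (hv0 0)
  have hD₁ : 0 ≤ D₁ := (norm_nonneg _).trans (hv1 0)
  have hρc : Continuous ρ := hρ.continuous
  have hρdiff : Differentiable ℝ ρ := hρ.differentiable one_ne_zero
  have hρ1c : Continuous fun x => fderiv ℝ ρ x e :=
    (hρ.continuous_fderiv one_ne_zero).clm_apply continuous_const
  have hvc : Continuous v := hv.continuous
  have hvd : Differentiable ℝ v := hv.differentiable one_ne_zero
  have hv1c : Continuous fun x => fderiv ℝ v x e :=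
    (hv.continuous_fderiv one_ne_zero).clm_apply continuous_const
  have hud : Differentiable ℝ u := hu.differentiable two_ne_zero
  have hu1' : ContDiff ℝ 1 (fun y => fderiv ℝ u y e) :=
    (hu.fderiv_right (m := 1) le_rfl).clm_apply contDiff_const
  have hu1c : Continuous (fun y => fderiv ℝ u y e) := hu1'.continuous
  have hu1d : Differentiable ℝ (fun y => fderiv ℝ u y e) := hu1'.differentiable one_ne_zero
  have hu2c : Continuous (fun x => fderiv ℝ (fun y => fderiv ℝ u y e) x e) :=
    (hu1'.continuous_fderiv one_ne_zero).clm_apply continuous_const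
  -- bounds on the derivatives along `e`
  have hbu1 : ∀ x, ‖fderiv ℝ u x e‖ ≤ C₁ * ‖e‖ := fun x =>
    ((fderiv ℝ u x).le_opNorm e).trans (mul_le_mul_of_nonneg_right (hu1 x) (norm_nonneg _))
  have hbv1 : ∀ x, ‖fderiv ℝ v x e‖ ≤ D₁ * ‖e‖ := fun x =>
    ((fderiv ℝ v x).le_opNorm e).trans (mul_le_mul_of_nonneg_right (hv1 x) (norm_nonneg _))
  have hbρ1 : ∀ x, ‖fderiv ℝ ρ x e‖ ≤ ‖fderiv ℝ ρ x‖ * ‖e‖ := fun x => (fderiv ℝ ρ x).le_opNorm e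
  have hbu2 : ∀ x, ‖fderiv ℝ (fun y => fderiv ℝ u y e) x e‖ ≤ C₂ * ‖e‖ * ‖e‖ := by
    intro x
    have hd : DifferentiableAt ℝ (fderiv ℝ u) x :=
      ((hu.fderiv_right (m := 1) le_rfl).differentiable one_ne_zero).differentiableAt
    rw [fderiv_clm_apply hd (differentiableAt_const e)]
    simp only [fderiv_fun_const, Pi.zero_apply, ContinuousLinearMap.comp_zero, zero_add,
      ContinuousLinearMap.flip_apply]
    calc ‖fderiv ℝ (fderiv ℝ u) x e e‖ ≤ ‖fderiv ℝ (fderiv ℝ u) x e‖ * ‖e‖ :=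
          ContinuousLinearMap.le_opNorm _ _
      _ ≤ ‖fderiv ℝ (fderiv ℝ u) x‖ * ‖e‖ * ‖e‖ := by
          gcongr; exact ContinuousLinearMap.le_opNorm _ _
      _ ≤ C₂ * ‖e‖ * ‖e‖ := by gcongr; exact hu2 x
  -- the derivative of `v ρ`
  have hprod : ∀ x, HasFDerivAt (fun y => v y * ρ y)
      (v x • fderiv ℝ ρ x + ρ x • fderiv ℝ v x) x :=
    fun x => (hvd x).hasFDerivAt.mul (hρdiff x).hasFDerivAt
  have hprod' : ∀ x, fderiv ℝ (fun y => v y * ρ y) x e =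
      fderiv ℝ v x e * ρ x + v x * fderiv ℝ ρ x e := by
    intro x
    rw [(hprod x).fderiv]
    simp only [add_apply, FunLike.coe_smul, Pi.smul_apply, smul_eq_mul]
    ring
  -- integrability of the three products
  have i1 : Integrable fun x => fderiv ℝ (fun y => v y * ρ y) x e * fderiv ℝ u x e := by
    have hmeas : AEStronglyMeasurable
        (fun x => fderiv ℝ (fun y => v y * ρ y) x e * fderiv ℝ u x e) volume := by
      simp_rw [hprod']
      exact (((hv1c.mul hρc).add (hvc.mul hρ1c)).mul hu1c).aestronglyMeasurable
    refine Integrable.mono' ((hρi.norm.const_mul (D₁ * ‖e‖ * (C₁ * ‖e‖))).add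
      (hρd.const_mul (D₀ * ‖e‖ * (C₁ * ‖e‖)))) hmeas (Eventually.of_forall fun x => ?_)
    rw [hprod', Pi.add_apply, add_mul]
    refine (norm_add_le _ _).trans (add_le_add ?_ ?_)
    · rw [norm_mul, norm_mul]
      calc ‖fderiv ℝ v x e‖ * ‖ρ x‖ * ‖fderiv ℝ u x e‖ ≤ D₁ * ‖e‖ * ‖ρ x‖ * (C₁ * ‖e‖) :=
            mul_le_mul (mul_le_mul_of_nonneg_right (hbv1 x) (norm_nonneg _)) (hbu1 x)
              (norm_nonneg _) (by positivity)
        _ = D₁ * ‖e‖ * (C₁ * ‖e‖) * ‖ρ x‖ := by ring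
    · rw [norm_mul, norm_mul]
      calc ‖v x‖ * ‖fderiv ℝ ρ x e‖ * ‖fderiv ℝ u x e‖
          ≤ D₀ * (‖fderiv ℝ ρ x‖ * ‖e‖) * (C₁ * ‖e‖) :=
            mul_le_mul (mul_le_mul (hv0 x) (hbρ1 x) (norm_nonneg _) hD₀) (hbu1 x)
              (norm_nonneg _) (by positivity)
        _ = D₀ * ‖e‖ * (C₁ * ‖e‖) * ‖fderiv ℝ ρ x‖ := by ring
  have i2 : Integrable fun x => v x * ρ x * fderiv ℝ (fun y => fderiv ℝ u y e) x e := by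
    have : (fun x => v x * ρ x * fderiv ℝ (fun y => fderiv ℝ u y e) x e) =
        fun x => (v x * fderiv ℝ (fun y => fderiv ℝ u y e) x e) * ρ x := by
      funext x; ring
    rw [this]
    exact hρi.bdd_mul (hvc.mul hu2c).aestronglyMeasurable (Eventually.of_forall fun x => by
      rw [norm_mul]; exact mul_le_mul (hv0 x) (hbu2 x) (norm_nonneg _) hD₀)
  have i3 : Integrable fun x => v x * ρ x * fderiv ℝ u x e := by
    have : (fun x => v x * ρ x * fderiv ℝ u x e) =
        fun x => (v x * fderiv ℝ u x e) * ρ x := by funext x; ring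
    rw [this]
    exact hρi.bdd_mul (hvc.mul hu1c).aestronglyMeasurable (Eventually.of_forall fun x => by
      rw [norm_mul]; exact mul_le_mul (hv0 x) (hbu1 x) (norm_nonneg _) hD₀)
  -- integration by parts
  have hibp := integral_mul_fderiv_eq_neg_fderiv_mul_of_integrable i1 i2 i3
    (fun x _ => (hprod x).differentiableAt) (fun x _ => hu1d x)
  rw [hibp]
  simp_rw [hprod', add_mul]
  have ia : Integrable fun x => fderiv ℝ v x e * ρ x * fderiv ℝ u x e := by
    have : (fun x => fderiv ℝ v x e * ρ x * fderiv ℝ u x e) =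
        fun x => (fderiv ℝ v x e * fderiv ℝ u x e) * ρ x := by funext x; ring
    rw [this]
    exact hρi.bdd_mul (hv1c.mul hu1c).aestronglyMeasurable (Eventually.of_forall fun x => by
      rw [norm_mul]; exact mul_le_mul (hbv1 x) (hbu1 x) (norm_nonneg _) (by positivity))
  have ib : Integrable fun x => v x * fderiv ℝ ρ x e * fderiv ℝ u x e := by
    refine Integrable.mono' (hρd.const_mul (D₀ * ‖e‖ * (C₁ * ‖e‖)))
      ((hvc.mul hρ1c).mul hu1c).aestronglyMeasurable (Eventually.of_forall fun x => ?_)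
    rw [norm_mul, norm_mul]
    calc ‖v x‖ * ‖fderiv ℝ ρ x e‖ * ‖fderiv ℝ u x e‖
        ≤ D₀ * (‖fderiv ℝ ρ x‖ * ‖e‖) * (C₁ * ‖e‖) :=
          mul_le_mul (mul_le_mul (hv0 x) (hbρ1 x) (norm_nonneg _) hD₀) (hbu1 x)
            (norm_nonneg _) (by positivity)
      _ = D₀ * ‖e‖ * (C₁ * ‖e‖) * ‖fderiv ℝ ρ x‖ := by ring
  rw [integral_add ia ib, neg_add, sub_eq_add_neg]
  congr 1
  · congr 1
    refine integral_congr_ae (Eventually.of_forall fun x => ?_)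
    ring
  · congr 1
    refine integral_congr_ae (Eventually.of_forall fun x => ?_)
    ring

/-- **Green's first identity with a weight.** For `ρ ∈ C¹ ∩ L¹` with `‖Dρ‖ ∈ L¹`, `u ∈ C²` with
`Du, D²u` bounded, `v ∈ C¹` with `v, Dv` bounded, and any orthonormal basis `(bᵢ)`:
`∫ (Δu) v ρ = −∫ (∑ᵢ ∂ᵢu ∂ᵢv) ρ − ∫ v ∑ᵢ ∂ᵢu ∂ᵢρ`, i.e. `∫ (Δu) v ρ = −∫ ∇u·∇v ρ − ∫ v ∇u·∇ρ`.
[folklore] -/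
theorem integral_laplacian_mul_mul_weight {ι : Type*} [Fintype ι] (b : OrthonormalBasis ι ℝ E) :
    ∫ x, Δ u x * v x * ρ x =
      -(∫ x, (∑ i, fderiv ℝ u x (b i) * fderiv ℝ v x (b i)) * ρ x) -
        ∫ x, v x * ∑ i, fderiv ℝ u x (b i) * fderiv ℝ ρ x (b i) := by
  have hC₁ : 0 ≤ C₁ := (norm_nonneg _).trans (hu1 0)
  have hD₀ : 0 ≤ D₀ := (norm_nonneg _).trans (hv0 0)
  have hρc : Continuous ρ := hρ.continuous
  have hρ1c : ∀ e, Continuous fun x => fderiv ℝ ρ x e := fun e =>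
    (hρ.continuous_fderiv one_ne_zero).clm_apply continuous_const
  have hvc : Continuous v := hv.continuous
  have hv1c : ∀ e, Continuous fun x => fderiv ℝ v x e := fun e =>
    (hv.continuous_fderiv one_ne_zero).clm_apply continuous_const
  have hu1' : ∀ e, ContDiff ℝ 1 (fun y => fderiv ℝ u y e) := fun e =>
    (hu.fderiv_right (m := 1) le_rfl).clm_apply contDiff_const
  have hu1c : ∀ e, Continuous (fun y => fderiv ℝ u y e) := fun e => (hu1' e).continuous
  have hu2c : ∀ e, Continuous (fun x => fderiv ℝ (fun y => fderiv ℝ u y e) x e) := fun e =>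
    ((hu1' e).continuous_fderiv one_ne_zero).clm_apply continuous_const
  have hbu1 : ∀ x e, ‖fderiv ℝ u x e‖ ≤ C₁ * ‖e‖ := fun x e =>
    ((fderiv ℝ u x).le_opNorm e).trans (mul_le_mul_of_nonneg_right (hu1 x) (norm_nonneg _))
  have hbv1 : ∀ x e, ‖fderiv ℝ v x e‖ ≤ D₁ * ‖e‖ := fun x e =>
    ((fderiv ℝ v x).le_opNorm e).trans (mul_le_mul_of_nonneg_right (hv1 x) (norm_nonneg _))
  have hbρ1 : ∀ x e, ‖fderiv ℝ ρ x e‖ ≤ ‖fderiv ℝ ρ x‖ * ‖e‖ := fun x e =>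
    (fderiv ℝ ρ x).le_opNorm e
  have hbu2 : ∀ x e, ‖fderiv ℝ (fun y => fderiv ℝ u y e) x e‖ ≤ C₂ * ‖e‖ * ‖e‖ := by
    intro x e
    have hd : DifferentiableAt ℝ (fderiv ℝ u) x :=
      ((hu.fderiv_right (m := 1) le_rfl).differentiable one_ne_zero).differentiableAt
    rw [fderiv_clm_apply hd (differentiableAt_const e)]
    simp only [fderiv_fun_const, Pi.zero_apply, ContinuousLinearMap.comp_zero, zero_add,
      ContinuousLinearMap.flip_apply]
    calc ‖fderiv ℝ (fderiv ℝ u) x e e‖ ≤ ‖fderiv ℝ (fderiv ℝ u) x e‖ * ‖e‖ :=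
          ContinuousLinearMap.le_opNorm _ _
      _ ≤ ‖fderiv ℝ (fderiv ℝ u) x‖ * ‖e‖ * ‖e‖ := by
          gcongr; exact ContinuousLinearMap.le_opNorm _ _
      _ ≤ C₂ * ‖e‖ * ‖e‖ := by gcongr; exact hu2 x
  -- pointwise expansion of the left integrand along the basis
  have hpt : ∀ x, Δ u x * v x * ρ x =
      ∑ i, v x * ρ x * fderiv ℝ (fun y => fderiv ℝ u y (b i)) x (b i) := by
    intro x
    rw [laplacian_eq_sum_fderiv_fderiv_apply b hu, Finset.sum_mul, Finset.sum_mul]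
    exact Finset.sum_congr rfl fun i _ => by ring
  simp_rw [hpt]
  -- integrability of the summands
  have iA : ∀ i, Integrable fun x => v x * ρ x * fderiv ℝ (fun y => fderiv ℝ u y (b i)) x (b i) := by
    intro i
    have : (fun x => v x * ρ x * fderiv ℝ (fun y => fderiv ℝ u y (b i)) x (b i)) =
        fun x => (v x * fderiv ℝ (fun y => fderiv ℝ u y (b i)) x (b i)) * ρ x := by
      funext x; ring
    rw [this]
    exact hρi.bdd_mul (hvc.mul (hu2c _)).aestronglyMeasurable (Eventually.of_forall fun x => by
      rw [norm_mul]; exact mul_le_mul (hv0 x) (hbu2 x _) (norm_nonneg _) hD₀)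
  have iB : ∀ i, Integrable fun x => fderiv ℝ u x (b i) * fderiv ℝ v x (b i) * ρ x := fun i =>
    hρi.bdd_mul ((hu1c _).mul (hv1c _)).aestronglyMeasurable (Eventually.of_forall fun x => by
      rw [norm_mul]; exact mul_le_mul (hbu1 x _) (hbv1 x _) (norm_nonneg _) (by positivity))
  have iC : ∀ i, Integrable fun x => v x * fderiv ℝ u x (b i) * fderiv ℝ ρ x (b i) := by
    intro i
    refine Integrable.mono' (hρd.const_mul (D₀ * (C₁ * ‖b i‖) * ‖b i‖))
      ((hvc.mul (hu1c _)).mul (hρ1c _)).aestronglyMeasurable (Eventually.of_forall fun x => ?_)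
    rw [norm_mul, norm_mul]
    calc ‖v x‖ * ‖fderiv ℝ u x (b i)‖ * ‖fderiv ℝ ρ x (b i)‖
        ≤ D₀ * (C₁ * ‖b i‖) * (‖fderiv ℝ ρ x‖ * ‖b i‖) :=
          mul_le_mul (mul_le_mul (hv0 x) (hbu1 x _) (norm_nonneg _) hD₀) (hbρ1 x _)
            (norm_nonneg _) (by positivity)
      _ = D₀ * (C₁ * ‖b i‖) * ‖b i‖ * ‖fderiv ℝ ρ x‖ := by ring
  rw [integral_finsetSum _ (fun i _ => iA i)]
  simp_rw [integral_mul_mul_fderiv_fderiv_weight hρ hρi hρd hu hv hu1 hu2 hv0 hv1]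
  rw [Finset.sum_sub_distrib, Finset.sum_neg_distrib, ← integral_finsetSum _ (fun i _ => iB i),
    ← integral_finsetSum _ (fun i _ => iC i)]
  congr 1
  · congr 2
    funext x
    rw [Finset.sum_mul]
  · congr 1
    funext x
    rw [Finset.mul_sum]
    exact Finset.sum_congr rfl fun i _ => by ring

end WeightedIBP

section OrnsteinUhlenbeck

variable {ρ V u v : E → ℝ} (hρ : ContDiff ℝ 1 ρ) (hρi : Integrable ρ)
  (hρd : Integrable fun x => ‖fderiv ℝ ρ x‖)
  (hV : ∀ x w, fderiv ℝ ρ x w = -(fderiv ℝ V x w * ρ x))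
  (hu : ContDiff ℝ 2 u) (hv : ContDiff ℝ 1 v) {C₁ C₂ D₀ D₁ : ℝ}
  (hu1 : ∀ x, ‖fderiv ℝ u x‖ ≤ C₁) (hu2 : ∀ x, ‖fderiv ℝ (fderiv ℝ u) x‖ ≤ C₂)
  (hv0 : ∀ x, ‖v x‖ ≤ D₀) (hv1 : ∀ x, ‖fderiv ℝ v x‖ ≤ D₁)
include hρ hρi hρd hV hu hv hu1 hu2 hv0 hv1

/-- **The Dirichlet form of `Δ − ∇V·∇` in `L²(ρ dx)`, `ρ = c e^{−V}`.** If the `C¹ ∩ L¹` weight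
`ρ` (with `‖Dρ‖ ∈ L¹`) satisfies `Dρ = −(DV) ρ`, then for `u ∈ C²` with `Du, D²u` bounded and
`v ∈ C¹` with `v, Dv` bounded,
`∫ (Δu − ∑ᵢ ∂ᵢV ∂ᵢu) v ρ = −∫ (∑ᵢ ∂ᵢu ∂ᵢv) ρ`
along any orthonormal basis: the drift–diffusion operator `Δ − ∇V·∇` (the ground-state conjugate
`ρ⁻¹ ∘ (∇·(∇ + ∇V)) ∘ ρ` of the Fokker–Planck operator) is symmetric and nonpositive in `L²(ρ dx)`
with Dirichlet form `∫ ∇u·∇v ρ` (Bakry–Gentil–Ledoux, §2.7.1 for the Gaussian case). [folklore] -/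
theorem integral_ornsteinUhlenbeck_mul_mul_weight {ι : Type*} [Fintype ι]
    (b : OrthonormalBasis ι ℝ E) :
    ∫ x, (Δ u x - ∑ i, fderiv ℝ V x (b i) * fderiv ℝ u x (b i)) * v x * ρ x =
      -∫ x, (∑ i, fderiv ℝ u x (b i) * fderiv ℝ v x (b i)) * ρ x := by
  have hC₁ : 0 ≤ C₁ := (norm_nonneg _).trans (hu1 0)
  have hC₂ : 0 ≤ C₂ := (norm_nonneg (fderiv ℝ (fderiv ℝ u) 0)).trans (hu2 0)
  have hD₀ : 0 ≤ D₀ := (norm_nonneg _).trans (hv0 0)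
  have hρc : Continuous ρ := hρ.continuous
  have hρ1c : ∀ e, Continuous fun x => fderiv ℝ ρ x e := fun e =>
    (hρ.continuous_fderiv one_ne_zero).clm_apply continuous_const
  have hvc : Continuous v := hv.continuous
  have hu1c : ∀ e, Continuous (fun y => fderiv ℝ u y e) := fun e =>
    ((hu.fderiv_right (m := 1) le_rfl).clm_apply contDiff_const).continuous
  have hu2c : Continuous (Δ u) := by
    have : Δ u = fun x => ∑ i, fderiv ℝ (fun y => fderiv ℝ u y (b i)) x (b i) :=
      funext fun x => laplacian_eq_sum_fderiv_fderiv_apply b hu x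
    rw [this]
    exact continuous_finsetSum _ fun i _ =>
      ((((hu.fderiv_right (m := 1) le_rfl).clm_apply contDiff_const).continuous_fderiv
        one_ne_zero).clm_apply continuous_const)
  have hbu1 : ∀ x e, ‖fderiv ℝ u x e‖ ≤ C₁ * ‖e‖ := fun x e =>
    ((fderiv ℝ u x).le_opNorm e).trans (mul_le_mul_of_nonneg_right (hu1 x) (norm_nonneg _))
  have hbρ1 : ∀ x e, ‖fderiv ℝ ρ x e‖ ≤ ‖fderiv ℝ ρ x‖ * ‖e‖ := fun x e =>
    (fderiv ℝ ρ x).le_opNorm e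
  -- the drift term is `−v ∑ᵢ ∂ᵢu ∂ᵢρ`, pointwise
  have hdrift : ∀ x, (∑ i, fderiv ℝ V x (b i) * fderiv ℝ u x (b i)) * v x * ρ x =
      -(v x * ∑ i, fderiv ℝ u x (b i) * fderiv ℝ ρ x (b i)) := by
    intro x
    rw [Finset.sum_mul, Finset.sum_mul, Finset.mul_sum, ← Finset.sum_neg_distrib]
    exact Finset.sum_congr rfl fun i _ => by rw [hV x (b i)]; ring
  -- Laplacian bound via the basis expansion
  have hΔb : ∀ x, ‖Δ u x‖ ≤ ∑ i : ι, C₂ * ‖b i‖ * ‖b i‖ := by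
    intro x
    rw [laplacian_eq_sum_fderiv_fderiv_apply b hu x]
    refine (norm_sum_le _ _).trans (Finset.sum_le_sum fun i _ => ?_)
    have hd : DifferentiableAt ℝ (fderiv ℝ u) x :=
      ((hu.fderiv_right (m := 1) le_rfl).differentiable one_ne_zero).differentiableAt
    rw [fderiv_clm_apply hd (differentiableAt_const _)]
    simp only [fderiv_fun_const, Pi.zero_apply, ContinuousLinearMap.comp_zero, zero_add,
      ContinuousLinearMap.flip_apply]
    calc ‖fderiv ℝ (fderiv ℝ u) x (b i) (b i)‖ ≤ ‖fderiv ℝ (fderiv ℝ u) x (b i)‖ * ‖b i‖ :=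
          ContinuousLinearMap.le_opNorm _ _
      _ ≤ ‖fderiv ℝ (fderiv ℝ u) x‖ * ‖b i‖ * ‖b i‖ := by
          gcongr; exact ContinuousLinearMap.le_opNorm _ _
      _ ≤ C₂ * ‖b i‖ * ‖b i‖ := by gcongr; exact hu2 x
  have iΔ : Integrable fun x => Δ u x * v x * ρ x := by
    have : (fun x => Δ u x * v x * ρ x) = fun x => (Δ u x * v x) * ρ x := by funext x; ring
    rw [this]
    exact hρi.bdd_mul (hu2c.mul hvc).aestronglyMeasurable (Eventually.of_forall fun x => by
      rw [norm_mul]; exact mul_le_mul (hΔb x) (hv0 x) (norm_nonneg _)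
        (Finset.sum_nonneg fun i _ => by positivity))
  have iC : ∀ i, Integrable fun x => v x * fderiv ℝ u x (b i) * fderiv ℝ ρ x (b i) := by
    intro i
    refine Integrable.mono' (hρd.const_mul (D₀ * (C₁ * ‖b i‖) * ‖b i‖))
      ((hvc.mul (hu1c _)).mul (hρ1c _)).aestronglyMeasurable (Eventually.of_forall fun x => ?_)
    rw [norm_mul, norm_mul]
    calc ‖v x‖ * ‖fderiv ℝ u x (b i)‖ * ‖fderiv ℝ ρ x (b i)‖
        ≤ D₀ * (C₁ * ‖b i‖) * (‖fderiv ℝ ρ x‖ * ‖b i‖) :=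
          mul_le_mul (mul_le_mul (hv0 x) (hbu1 x _) (norm_nonneg _) hD₀) (hbρ1 x _)
            (norm_nonneg _) (by positivity)
      _ = D₀ * (C₁ * ‖b i‖) * ‖b i‖ * ‖fderiv ℝ ρ x‖ := by ring
  have idrift : Integrable fun x => v x * ∑ i, fderiv ℝ u x (b i) * fderiv ℝ ρ x (b i) := by
    have : (fun x => v x * ∑ i, fderiv ℝ u x (b i) * fderiv ℝ ρ x (b i)) =
        fun x => ∑ i, v x * fderiv ℝ u x (b i) * fderiv ℝ ρ x (b i) := by
      funext x; rw [Finset.mul_sum]; exact Finset.sum_congr rfl fun i _ => by ring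
    rw [this]
    exact integrable_finsetSum _ fun i _ => iC i
  have idn : Integrable fun x => -(v x * ∑ i, fderiv ℝ u x (b i) * fderiv ℝ ρ x (b i)) :=
    idrift.neg
  simp_rw [sub_mul]
  simp_rw [hdrift]
  rw [integral_sub iΔ idn, integral_neg,
    integral_laplacian_mul_mul_weight hρ hρi hρd hu hv hu1 hu2 hv0 hv1 b]
  ring

omit hv hv0 hv1 in
/-- **The Dirichlet form of `Δ − ∇V·∇`, diagonal case**: for `u ∈ C²` with `u, Du, D²u` bounded,
`∫ (Δu − ∑ᵢ ∂ᵢV ∂ᵢu) u ρ = −∫ ‖Du‖² ρ ≤ 0` (`ρ = c e^{−V} ∈ C¹ ∩ L¹`, `‖Dρ‖ ∈ L¹`). [folklore] -/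
theorem integral_ornsteinUhlenbeck_mul_self_mul_weight {ι : Type*} [Fintype ι]
    (b : OrthonormalBasis ι ℝ E) {C₀ : ℝ} (hu0 : ∀ x, ‖u x‖ ≤ C₀) :
    ∫ x, (Δ u x - ∑ i, fderiv ℝ V x (b i) * fderiv ℝ u x (b i)) * u x * ρ x =
      -∫ x, ‖fderiv ℝ u x‖ ^ 2 * ρ x := by
  rw [integral_ornsteinUhlenbeck_mul_mul_weight hρ hρi hρd hV hu (hu.of_le one_le_two) hu1 hu2
    hu0 hu1 b]
  congr 2
  funext x
  rw [← sum_sq_apply_orthonormalBasis b (fderiv ℝ u x)]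
  congr 1
  exact Finset.sum_congr rfl fun i _ => by ring

end OrnsteinUhlenbeck

end Literature.Analysis.UnboundedOperators
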